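import Summits.ResolutionOfSingularities.ResolutionOfSingularities.Theorems.HomologicalConductorNoZenoRSurfacePrincipalization
import Literature.AlgebraicGeometry.Resolution.ResolutionDominatedByBlowup
import Literature.AlgebraicGeometry.Resolution.FundamentalLocus
import Literature.AlgebraicGeometry.Resolution.BlowupsComposition
import Literature.AlgebraicGeometry.Resolution.BlowupsProduct
import Literature.AlgebraicGeometry.Resolution.BlowupsExistence
import Literature.AlgebraicGeometry.Resolution.BlowupsLocal
import Literature.AlgebraicGeometry.Resolution.StrictTransformOpenImmersion
import Literature.AlgebraicGeometry.Resolution.ArithmeticalThreefoldsBlowupFormDimThree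
import Literature.AlgebraicGeometry.Resolution.BirationalDimensionReduced
import Literature.AlgebraicGeometry.Resolution.RationalSurfaceSingularitiesBasic
import Literature.AlgebraicGeometry.Resolution.MarkedIdealsLemmas
import Literature.AlgebraicGeometry.Resolution.ComponentGluing
import Literature.AlgebraicGeometry.Motives.GoodReductionSpecialFibreProofs
import HarnessLib

/-!
# Crux `NoZenoR` (stmt-ResolutionOfSingularities-19943) — toward the W3 print `Lipman1969_4_1`:
# a two-dimensional normal local domain with a desingularization has a desingularization which
# IS A BLOWING UP along an ideal cosupported at the closed point

Route `ResolutionOfSingularities/HomologicalConductor` (cell decomp-res, hand leafhand-res-homologicalconduct-16 g4).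
OURS: AI-written, weaker than expert review; SUPPORT level, counted 0; def-free, fact-free (no named fact is used).
Nothing here is a statement of the manuscript under review (Hironaka 2017); no crux / summit statement is proved.

THE MATHEMATICS (folklore assembly, print-free).  Let `S` be a Noetherian normal domain of Krull dimension `≤ 2` and
`π : X → Spec S` a desingularization (`IsResolution`: proper, birational, `X` regular).  Then there is a desingularization
`π' : X' → Spec S` which is a blowing up (`IsBlowup`, universal property) along an ideal sheaf `I'` of `Spec S` whose
cosupport consists of points of codimension `≥ 2` — for `S` local of dimension `2`: cosupported at the closed point,
i.e. `π'` is the blowing up of an `𝔪`-primary ideal (or of the unit ideal).  Proof: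
1. `π` is an isomorphism over its iso-locus `U` (`Scheme.Hom.isoLocus`), which contains every normal point of
   codimension `≤ 1` (`mem_isoLocus_of_ringKrullDim_le_one`, Zariski);
2. Stacks 081T + the divisorial part (`exists_isBlowup_dominating_codimTwo_finite`): a `U`-admissible blowing up
   `b : S' = Bl_I(Spec S) → Spec S`, `V(I) = Uᶜ`, and `r : S' → X` over `Spec S` which is the blowing up of `X` along an
   ideal `J` with `V(J)` a finite set of closed points off `π⁻¹U`;
3. principalization on the regular surface `X` (`exists_isPointBlowupComposition_isLocallyPrincipal_noexc`, hand 18 g0):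
   a composition of point blowing ups `q : X' → X` centred over `V(J)` with `J·𝒪_{X'}` invertible; `X'` is regular;
4. `q` is a blowing up of `X` along an ideal `Q` with `V(Q) ⊆ V(J)` (Stacks 080B, `IsBlowup.exists_isBlowup_comp`), hence
   ALSO along `Q·J` (`IsBlowup.mul_of_isEffectiveCartier_comap`: `J` becomes invertible upstairs); by Stacks 080A
   (`IsBlowup.comp`) `Bl_{r⁻¹Q}(S') → S' → X` is another blowing up of `X` along `J·Q`, so `X' ≅ Bl_{r⁻¹Q}(S')` over `X`
   (`IsBlowup.unique`) and `X' → S'` is a blowing up along `r⁻¹Q 𝒪_{S'}`;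
5. Stacks 080B again: `X' → S' → Spec S` is a blowing up of `Spec S` along some `I'` with
   `V(I') ⊆ V(I) ∪ b(V(r⁻¹Q)) ⊆ Uᶜ`; and `X' → Spec S = q ≫ π` is a desingularization.

* `exists_isBlowup_of_isPointBlowupComposition` — a composition of point blowing ups of a Noetherian scheme is a blowing
  up along an ideal cosupported in the set of (images of the) centres;
* `ringKrullDim_stalk_Spec_le_one_of_ne_closedPoint` — in a local ring of dimension `≤ 2` the non-closed points of `Spec`
  have local rings of dimension `≤ 1`;
* `exists_isResolution_isBlowup` — MAIN (normal Noetherian domain `S`, `dim X ≤ 2`): a desingularization that is a blowing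
  up along `I'` with every point of `V(I')` outside the iso-locus of the given `π`;
* `exists_isResolution_isBlowup_support_subset_closedPoint` — the local reading (`S` local, `dim S ≤ 2`): `V(I') ⊆ {𝔪}`.

Use: the LOCAL INPUT of a print-free globalisation of desingularizations of normal surfaces with finitely many singular
points (existence half of Lipman (4.1)): blowing ups of `𝔪_y`-primary ideals globalise as blowing ups of `Y`.
-/

noncomputable section

-- single-problem summit: the doubled namespace component `ResolutionOfSingularities` is forced
set_option linter.dupNamespace false

open CategoryTheory AlgebraicGeometry TopologicalSpace IsLocalRing
open Literature.AlgebraicGeometry.Resolution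
open Summit.ResolutionOfSingularities.ResolutionOfSingularities.Theorems.F75c
open Summit.ResolutionOfSingularities.ResolutionOfSingularities.Theorems.NoZeno.Lipman12B

universe u

namespace Summit.ResolutionOfSingularities.ResolutionOfSingularities.Theorems.NoZeno.ResolutionIsBlowup

/-! ## A composition of point blowing ups is a blowing up -/

/-- **A composition of point blowing ups is a blowing up** along an ideal sheaf cosupported in the set `T` over which the
centres lie (induction on the composition with Stacks 080B, `IsBlowup.exists_isBlowup_comp_supported`).
[cite: StacksProject, Tag 080B] -/
theorem exists_isBlowup_of_isPointBlowupComposition {X : Scheme.{u}} [IsNoetherian X] {T : Set X} :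
    ∀ {X' : Scheme.{u}} {π : X' ⟶ X}, IsPointBlowupComposition T π →
      ∃ Q : X.IdealSheafData, IsBlowup π Q ∧ (Q.support : Set X) ⊆ T := by
  intro X' π h
  induction h with
  | nil =>
    refine ⟨⊤, isBlowup_id_top X, ?_⟩
    rw [Scheme.IdealSheafData.support_top]
    exact fun x hx => False.elim hx
  | cons τ σ x' hx' hσ hne hT hτ ih =>
    obtain ⟨Q, hQ, hQT⟩ := ih
    obtain ⟨Q', hQ', hQ'T⟩ := IsBlowup.exists_isBlowup_comp_supported σ Q τ
      (Scheme.IdealSheafData.vanishingIdeal ⟨{x'}, hx'⟩) T hQ hQT hτ (by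
        rw [Scheme.IdealSheafData.coe_support_vanishingIdeal]
        intro y hy
        rw [Set.mem_singleton_iff.mp hy]
        exact hT)
    exact ⟨Q', hQ', hQ'T⟩

/-! ## Points of `Spec` of a local ring of dimension `≤ 2` off the closed point -/

/-- In a local ring `S` of Krull dimension `≤ 2`, the local ring of `Spec S` at a point other than the closed point has
dimension `≤ 1` (its height is at most `ht 𝔪 - 1`). [folklore] -/
theorem ringKrullDim_stalk_Spec_le_one_of_ne_closedPoint {S : Type u} [CommRing S] [IsLocalRing S]
    (hS : ringKrullDim S ≤ 2) (p : Spec (.of S)) (hp : p ≠ closedPoint S) :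
    ringKrullDim ((Spec (.of S)).presheaf.stalk p) ≤ 1 := by
  -- the stalk is the localization at `p`
  letI : Algebra S ((Spec (.of S)).presheaf.stalk p) := (StructureSheaf.toStalk S p).hom.toAlgebra
  have hloc : IsLocalization.AtPrime ((Spec (.of S)).presheaf.stalk p) p.asIdeal :=
    StructureSheaf.IsLocalization.to_stalk S p
  rw [ringKrullDim_eq_of_ringEquiv (IsLocalization.algEquiv p.asIdeal.primeCompl
    ((Spec (.of S)).presheaf.stalk p) (Localization.AtPrime p.asIdeal)).toRingEquiv,
    IsLocalization.AtPrime.ringKrullDim_eq_height p.asIdeal (Localization.AtPrime p.asIdeal)]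
  -- `ht p ≤ 1` since `p < 𝔪` and `ht 𝔪 = dim S ≤ 2`
  have hQ : p.asIdeal ≠ maximalIdeal S := fun h => hp (PrimeSpectrum.ext h)
  have hlt : p.asIdeal < maximalIdeal S := lt_of_le_of_ne (le_maximalIdeal Ideal.IsPrime.ne_top') hQ
  have h1 := Ideal.height_add_one_le_of_lt_of_isPrime hlt
  have hm := IsLocalRing.maximalIdeal_height_eq_ringKrullDim (R := S)
  have h2 : ((maximalIdeal S).height : WithBot ℕ∞) ≤ 2 := by rw [hm]; exact hS
  have h3 : (maximalIdeal S).height ≤ 2 := by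
    rw [show (2 : WithBot ℕ∞) = ((2 : ℕ∞) : WithBot ℕ∞) from rfl, WithBot.coe_le_coe] at h2
    exact h2
  have hfin : p.asIdeal.height ≠ ⊤ := by
    intro h; rw [h] at h1; exact absurd (h1.trans h3) (by decide)
  obtain ⟨n, hn⟩ := ENat.ne_top_iff_exists.mp hfin
  rw [← hn] at h1
  have h4 : ((n + 1 : ℕ) : ℕ∞) ≤ 2 := by push_cast; exact h1.trans h3
  have h5 : n + 1 ≤ 2 := by exact_mod_cast h4
  rw [← hn]
  have h6 : (n : ℕ∞) ≤ (1 : ℕ∞) := by exact_mod_cast (by omega : n ≤ 1)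
  exact_mod_cast h6

/-! ## The theorem -/

/-- **A desingularization which is a blowing up** (normal Noetherian domain `S`, a desingularization `π : X → Spec S` with
`dim X ≤ 2`): there is a desingularization `π' : X' → Spec S` which is a blowing up of `Spec S` along an ideal sheaf `I'`
all of whose cosupport lies outside the iso-locus of `π` — in particular at points whose local rings have dimension `≥ 2`
(Zariski: normal points of codimension `≤ 1` are in the iso-locus).  Assembly of Stacks 081T/080A/080B with principalization
of ideals on regular surfaces by point blowing ups (module docstring, steps 1–5). [this work] -/
theorem exists_isResolution_isBlowup {S : Type u} [CommRing S] [IsNoetherianRing S] [IsDomain S]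
    [IsIntegrallyClosed S] {X : Scheme.{u}} {π : X ⟶ Spec (.of S)} (hπ : IsResolution π)
    (hdim : topologicalKrullDim X ≤ 2) :
    ∃ (X' : Scheme.{u}) (π' : X' ⟶ Spec (.of S)) (I' : (Spec (.of S)).IdealSheafData),
      IsResolution π' ∧ IsBlowup π' I' ∧ (I'.support : Set (Spec (.of S))) ⊆ (π.isoLocus : Set (Spec (.of S)))ᶜ := by
  haveI : IsProper π := hπ.isProper
  haveI : IsIntegral X := hπ.isIntegral_source
  haveI : IsNoetherian X := by
    haveI : IsLocallyNoetherian X := LocallyOfFiniteType.isLocallyNoetherian π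
    haveI : CompactSpace X := QuasiCompact.compactSpace_of_compactSpace π
    exact {}
  have hX : Scheme.IsRegular X := hπ.isRegular
  -- step 1: the iso-locus
  let U : (Spec (.of S)).Opens := π.isoLocus
  haveI hUiso : IsIso (π ∣_ U) := isIso_morphismRestrict_isoLocus π
  have hUc : IsCompact (U : Set (Spec (.of S))) := NoetherianSpace.isCompact _
  have hne : ((π ⁻¹ᵁ U : X.Opens) : Set X).Nonempty := by
    obtain ⟨U₀, -, hU₀dense, hU₀iso⟩ := hπ.isBirational
    haveI := hU₀iso
    have hle : U₀ ≤ U := le_isoLocus π U₀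
    obtain ⟨x, hx⟩ := hU₀dense.nonempty
    exact ⟨x, hle hx⟩
  -- step 2: Stacks 081T + divisorial part
  obtain ⟨I, S', b, r, J, hbI, hIsupp, hrb, hrJ, -, hJsupp, -, -, -, -⟩ :=
    exists_isBlowup_dominating_codimTwo_finite (π := π) hX hdim U hUc hne
  -- step 3: principalization of `J` by point blowing ups
  obtain ⟨X', q, hq, hJq⟩ := exists_isPointBlowupComposition_isLocallyPrincipal_noexc X hX hdim J
  obtain ⟨hX'N, hX'reg, -⟩ := IsPointBlowupComposition.invariants_noexc hq hX hdim
  haveI := hX'N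
  haveI : IsIntegral X' := hq.isIntegral inferInstance
  haveI : IsProper q := hq.isProper inferInstance
  -- `J` is non-zero: its cosupport misses the non-empty open `π⁻¹U`
  have hJ0 : J ≠ ⊥ := by
    intro hJ
    obtain ⟨x, hx⟩ := hne
    have : x ∈ (J.support : Set X) := by rw [hJ, Scheme.IdealSheafData.support_bot]; trivial
    exact hJsupp this hx
  -- step 4: `q` is a blowing up along `Q` (so `J·𝒪_{X'} ≠ 0` is invertible), hence along `Q · J = J · Q`
  obtain ⟨Q, hqQ, hQsupp⟩ := exists_isBlowup_of_isPointBlowupComposition hq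
  have hQtop : Q.support ≠ ⊤ := by
    intro h
    apply hJ0
    rw [← Scheme.IdealSheafData.support_eq_top_iff, eq_top_iff]
    intro x _
    exact nonPrincipalLocus_le_support J (hQsupp (show x ∈ (Q.support : Set X) by rw [h]; trivial))
  have hJq' : IsEffectiveCartier (J.comap q) :=
    hJq.isEffectiveCartier_of_ne_bot (hqQ.comap_ne_bot hQtop hJ0)
  have hqJQ : IsBlowup q (J * Q) := by
    rw [mul_comm]
    exact hqQ.mul_of_isEffectiveCartier_comap hJq'
  -- the blowing up of `S'` along `r⁻¹Q 𝒪_{S'}`, another blowing up of `X` along `J · Q` (Stacks 080A)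
  obtain ⟨X'', p', hp'⟩ := exists_isBlowup S' (Q.comap r)
  have hcomp : IsBlowup (p' ≫ r) (J * Q) := hrJ.comp hp'
  obtain ⟨e, he, -⟩ := hqJQ.unique hcomp
  -- `g := e.hom ≫ p' : X' → S'` is a blowing up of `S'` along `r⁻¹Q 𝒪_{S'}`
  have hg : IsBlowup (e.hom ≫ p') (Q.comap r) := hp'.iso_comp e
  -- step 5: Stacks 080B for `X' → S' → Spec S`
  obtain ⟨I', hI', hI'supp⟩ := hbI.exists_isBlowup_comp hg
  refine ⟨X', (e.hom ≫ p') ≫ b, I', ?_, hI', ?_⟩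
  · -- `(e.hom ≫ p') ≫ b = q ≫ π` is a desingularization
    have heq : (e.hom ≫ p') ≫ b = q ≫ π := by
      rw [← hrb, Category.assoc, ← Category.assoc p' r π, ← Category.assoc, he]
    rw [heq]
    exact ⟨inferInstance, ComponentGluing.IsBirational.comp (hq.isBirational inferInstance) hπ.isBirational, hX'reg⟩
  · -- cosupport: `V(I') ⊆ V(I) ∪ b(V(r⁻¹Q)) ⊆ Uᶜ`
    intro s hs
    rcases hI'supp hs with hs | ⟨s', hs', rfl⟩
    · rw [hIsupp] at hs
      exact hs
    · -- `s' ∈ r⁻¹ V(Q)`, `V(Q) ⊆ nonPrincipalLocus J ⊆ V(J) ⊆ (π⁻¹U)ᶜ`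
      have hs'Q : r.base s' ∈ (Q.support : Set X) := by
        have := hs'
        rw [Scheme.IdealSheafData.support_comap] at this
        exact this
      have hxJ : r.base s' ∈ (J.support : Set X) :=
        nonPrincipalLocus_le_support J (hQsupp hs'Q)
      have hxU : r.base s' ∉ ((π ⁻¹ᵁ U : X.Opens) : Set X) := fun h => hJsupp hxJ h
      intro hbU
      apply hxU
      show π.base (r.base s') ∈ (U : Set (Spec (.of S)))
      rw [← Scheme.Hom.comp_apply, hrb]
      exact hbU

/-- **Local reading** (`S` a normal Noetherian LOCAL domain of Krull dimension `≤ 2` admitting a desingularization):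
`Spec S` has a desingularization which is the blowing up along an ideal sheaf cosupported at the closed point — the blowing
up of an `𝔪`-primary ideal, or an isomorphism.  The points off the closed point have normal local rings of dimension `≤ 1`,
so lie in the iso-locus (`mem_isoLocus_of_ringKrullDim_le_one`). [this work] -/
theorem exists_isResolution_isBlowup_support_subset_closedPoint {S : Type u} [CommRing S] [IsNoetherianRing S]
    [IsLocalRing S] [IsDomain S] [IsIntegrallyClosed S] (hS : ringKrullDim S ≤ 2)
    {X : Scheme.{u}} {π : X ⟶ Spec (.of S)} (hπ : IsResolution π) :
    ∃ (X' : Scheme.{u}) (π' : X' ⟶ Spec (.of S)) (I' : (Spec (.of S)).IdealSheafData),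
      IsResolution π' ∧ IsBlowup π' I' ∧ (I'.support : Set (Spec (.of S))) ⊆ {closedPoint S} := by
  haveI : IsProper π := hπ.isProper
  haveI : IsIntegral X := hπ.isIntegral_source
  have hdimS : topologicalKrullDim (Spec (.of S)) ≤ 2 := by
    rw [show topologicalKrullDim (Spec (.of S)) = ringKrullDim S from
      (PrimeSpectrum.topologicalKrullDim_eq_ringKrullDim (R := S))]
    exact hS
  have hdim : topologicalKrullDim X ≤ 2 := (hπ.topologicalKrullDim_le_of_isNoetherian).trans hdimS
  obtain ⟨X', π', I', hπ', hI', hsupp⟩ := exists_isResolution_isBlowup hπ hdim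
  refine ⟨X', π', I', hπ', hI', fun p hp => ?_⟩
  by_contra hne
  apply hsupp hp
  -- `p ≠ 𝔪` lies in the iso-locus
  exact mem_isoLocus_of_ringKrullDim_le_one π hπ.isBirational ⊤
    (fun y _ => Literature.AlgebraicGeometry.Motives.isIntegrallyClosed_stalk_Spec (.of S) y) (Set.mem_univ p)
    (ringKrullDim_stalk_Spec_le_one_of_ne_closedPoint hS p hne)

end Summit.ResolutionOfSingularities.ResolutionOfSingularities.Theorems.NoZeno.ResolutionIsBlowup

end
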